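import Literature.AlgebraicGeometry.Frobenioids.PadicKummerRemark221
import Literature.AlgebraicGeometry.Frobenioids.PadicKummerGaloisFN
import Literature.NumberTheory.GaloisRepresentations.LocalUnitPowerIndexMonotone
import HarnessLib

/-!
# Frobenioids II, Remark 2.2.1: the Kummer injection `M^×/M^{×N} ↪ H¹(H, μ_N)` for `M = K̄^H`

Mochizuki, *The geometry of Frobenioids II*, Kyushu J. Math. **62** (2008) 401–460, §2, Definition
2.2 (ii)(c) and Remark 2.2.1 p. 18 [cite: MochizukiFrdII2008, Rmk 2.2.1 p.18]: "the [first
cohomology module portion of the] Galois-theoretic condition of Definition 2.2, (ii), (c), implies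
[upon translation into 'extension field-theoretic language'] that any element `f ∈ O^□(A)^H`
admits an `N`-th root `g ∈ O^□(A)`".  The "extension field-theoretic language" is Kummer theory
over the fixed field `M := K̄^H` of the open subgroup `H ≤ G_K`; this file supplies its
INJECTIVITY HALF at the arithmetic context `Def22Context.ofLocalField L H hH S`
(`PadicKummerLocalField.lean`) — piece FILE-A = (I_M) of the general-`N` proof of the named fact
`SaturatedInvariantsAdmitRoots` (abc-iut cell, D-0079 L-F register row F-1198 «GAP-2R»; design
memo abc-iut-L1-t6 g4; seat abc-iut-w5-d246):

* `mem_fixedField_map_toAlgEquiv_iff` — `x ∈ K̄^H ↔ σ x = x` for all `σ ∈ H`;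
* `exists_injective_unitsModPow_fixedField_to_h1` — **`M^×/M^{×N} ↪ H¹_cont(H, μ_N(K̄)|_H)`**
  for ANY field `K` with `N ≠ 0` in `K` and ANY subgroup `H ≤ G_K`: `x ↦ [σ ↦ σ(α)/α]` for
  `α^N = x` (the tree's `kummerCocycleOn`); if two classes agree then `σ(α/β)/(α/β) = σ(ζ)/ζ` for
  a root of unity `ζ`, so `α/(βζ) ∈ K̄^H = M` by the very definition of the fixed field and
  `x/y = (α/(βζ))^N ∈ M^{×N}` (the injectivity of Neukirch's `a ↦ χ_a`, *ANT* IV (3.6));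
* `natCard_unitsModPow_fixedField_le_natCard_h1_mu` — hence `#(M^×/M^{×N}) ≤ #H¹_cont(H, μ_N)`
  over a non-archimedean local field `K` of characteristic `0` (finiteness of the target:
  `finite_continuousCohomology_one_restrict`);
* `natCard_unitsModPow_fixedField_le_natCard_h1` — the same with the coefficients `μ_N(A) =
  μ_N(O^□_L)` of Def. 2.2 (ii)(c) acting through `H ↠ H_A` (`cohomologyEquiv_ofGalois` along
  `muCoeffIso`, for `μ_N(K̄) ⊆ L` and `O^□_L ∋` the `N`-th roots of unity);
* `finiteDimensional_fixedField_map_of_isOpen` — `[K̄^H : K] < ∞` for `H ⊴ G_K` open;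
* `natCard_unitsModPow_le_natCard_h1_of_algHom` — for ANY finite extension `F/K` with a
  `K`-homomorphism `F → M`: `#(F^×/F^{×N}) ≤ #H¹(H, μ_N(A))`, by the local unit-index
  monotonicity `LocalUnitIndex.natCard_quotient_range_powMonoidHom_le_of_algHom` (piece (P1)).

Proof-only (no definition, no named fact); nothing here concerns [IUTchIII]. Universe `0` as in
`PadicKummerSetting.lean`.

## References
* S. Mochizuki, *The geometry of Frobenioids II*, Kyushu J. Math. 62 (2008), Rmk. 2.2.1.
  [MochizukiFrdII2008]
* J. Neukirch, *Algebraic Number Theory* (1999), Ch. IV §3 Cor. (3.6) (Kummer theory).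
  [NeukirchANT1999]
* J.-P. Serre, *Cohomologie galoisienne*, II §5.2 Prop. 14 (finiteness). [SerreGaloisCohomology1997]
-/

noncomputable section

namespace Literature.AlgebraicGeometry.Frobenioids

namespace PadicKummer

namespace Def22Context

open Field IntermediateField CategoryTheory
open scoped ValuativeRel
open Literature.NumberTheory.GaloisRepresentations
open Literature.NumberTheory.GaloisRepresentations.LocalWeilDatum
open Literature.NumberTheory.GaloisRepresentations.DiscreteGaloisModule

section KummerInjection

variable {K : Type} [Field K] (H : Subgroup (absoluteGaloisGroup K)) (N : ℕ) [NeZero N]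

/-- Membership in the fixed field `M = K̄^H` of a subgroup `H ≤ G_K` (written through the
identification `absoluteGaloisGroup.toAlgEquiv`) is being fixed by every `σ ∈ H` ("`L^H` ... the
subfield of elements on which `H` acts trivially"). [cite: MochizukiFrdII2008, Rmk 2.2.1 p.18] -/
theorem mem_fixedField_map_toAlgEquiv_iff (x : AlgebraicClosure K) :
    x ∈ fixedField (H.map (absoluteGaloisGroup.toAlgEquiv K).toMonoidHom) ↔
      ∀ σ ∈ H, σ • x = x := by
  rw [IntermediateField.mem_fixedField_iff]
  constructor
  · intro h σ hσ
    exact h _ ⟨σ, hσ, rfl⟩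
  · rintro h g ⟨σ, hσ, rfl⟩
    exact h σ hσ

/-- **Kummer theory for the fixed field of a subgroup, injectivity half**: for `M = K̄^H` and
`N ≥ 1` invertible in `K`, the map `x ↦ [σ ↦ σ(α)/α]` (`α^N = x`) induces an INJECTION
`M^×/M^{×N} ↪ H¹_cont(H, μ_N(K̄)|_H)`: if the Kummer cocycles of `x, y ∈ M^×` are cohomologous,
`σ(α/β)/(α/β) = σ(ζ)/ζ` for a root of unity `ζ` and all `σ ∈ H`, so `α/(βζ) ∈ K̄^H = M` (the
DEFINITION of the fixed field) and `x/y = (α/(βζ))^N ∈ M^{×N}` — the injectivity of Neukirch's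
`a ↦ χ_a`, `χ_a(σ) = σ(ⁿ√a)/ⁿ√a`, here for the (possibly non-closed) subgroup `H`; the "extension
field-theoretic" content of FrdII Rmk. 2.2.1.
[cite: NeukirchANT1999, Ch. IV §3 Cor. (3.6)] [cite: MochizukiFrdII2008, Rmk 2.2.1 p.18] -/
theorem exists_injective_unitsModPow_fixedField_to_h1 [NeZero (N : K)] :
    ∃ G : (↥(fixedField (H.map (absoluteGaloisGroup.toAlgEquiv K).toMonoidHom)))ˣ ⧸
        (powMonoidHom N : _ →* _).range →
        continuousCohomology 1 ((mu K N).restrict (subgroupIncl H)).toTopRep,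
      Function.Injective G := by
  classical
  set M := fixedField (H.map (absoluteGaloisGroup.toAlgEquiv K).toMonoidHom) with hM
  have hN : 0 < N := NeZero.pos N
  -- an `N`-th root in `K̄` of each unit of `M`, as a unit of `K̄`
  have hroot : ∀ x : (↥M)ˣ, ∃ α : (AlgebraicClosure K)ˣ,
      (α : AlgebraicClosure K) ^ N = ((x : ↥M) : AlgebraicClosure K) := by
    intro x
    have hx0 : ((x : ↥M) : AlgebraicClosure K) ≠ 0 := by
      rw [Ne, ZeroMemClass.coe_eq_zero]
      exact x.ne_zero
    obtain ⟨a, ha⟩ := IsAlgClosed.exists_pow_nat_eq ((x : ↥M) : AlgebraicClosure K) hN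
    have ha0 : a ≠ 0 := fun h => hx0 (by rw [← ha, h, zero_pow hN.ne'])
    exact ⟨Units.mk0 a ha0, by rw [Units.val_mk0, ha]⟩
  choose rt hrt using hroot
  have hfix : ∀ (x : (↥M)ˣ) (σ : absoluteGaloisGroup K), σ ∈ H → σ • rt x ^ N = rt x ^ N := by
    intro x σ hσ
    apply Units.ext
    rw [Units.coe_smul, Units.val_pow_eq_pow_val, hrt]
    exact (mem_fixedField_map_toAlgEquiv_iff H _).1 (x : ↥M).2 σ hσ
  -- the class map on units
  let F : (↥M)ˣ → continuousCohomology 1 ((mu K N).restrict (subgroupIncl H)).toTopRep :=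
    fun x => oneCocycleClass _ (kummerCocycleOn H N (rt x) (hfix x))
  -- key: equal classes ⇒ `x / y` is an `N`-th power in `M`
  have key : ∀ x y : (↥M)ˣ, F x = F y → x * y⁻¹ ∈ (powMonoidHom N : (↥M)ˣ →* (↥M)ˣ).range := by
    intro x y hxy
    have h0 : oneCocycleClass _ (kummerCocycleOn H N (rt x) (hfix x) -
        kummerCocycleOn H N (rt y) (hfix y)) = 0 := by
      rw [oneCocycleClass_sub]
      exact sub_eq_zero.mpr hxy
    obtain ⟨v, hv⟩ := (oneCocycleClass_eq_zero_iff _ _).mp h0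
    -- `γ := α / (β ζ)` is fixed by `H`
    set ζ : (AlgebraicClosure K)ˣ := muVal K N v with hζ
    set γ : (AlgebraicClosure K)ˣ := rt x / (rt y * ζ) with hγ
    have hγfix : ∀ σ : absoluteGaloisGroup K, σ ∈ H → σ • γ = γ := by
      intro σ hσ
      have h1 := congrArg (muVal K N) (hv ⟨σ, hσ⟩)
      rw [Submodule.coe_sub, ContinuousMap.sub_apply, muVal_sub, muVal_kummerCocycleOn,
        muVal_kummerCocycleOn, muVal_sub] at h1
      have hρ : muVal K N ((((mu K N).restrict (subgroupIncl H)).toTopRep).ρ ⟨σ, hσ⟩ v) =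
          σ • muVal K N v := rfl
      rw [hρ] at h1
      change σ • rt x / rt x / (σ • rt y / rt y) = σ • ζ / ζ at h1
      -- `φ u := σ u / u` is a homomorphism on the commutative group `K̄ˣ`
      let φ : (AlgebraicClosure K)ˣ →* (AlgebraicClosure K)ˣ :=
        MulDistribMulAction.toMonoidHom (AlgebraicClosure K)ˣ σ / MonoidHom.id _
      have hφ : ∀ u, φ u = σ • u / u := fun u => rfl
      rw [← hφ, ← hφ, ← hφ] at h1
      have hφγ : φ γ = 1 := by
        rw [hγ, map_div, map_mul, ← h1, mul_comm (φ (rt y)), div_mul_cancel, div_self']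
      rw [hφ] at hφγ
      exact div_eq_one.mp hφγ
    have hγM : (γ : AlgebraicClosure K) ∈ M := by
      rw [hM, mem_fixedField_map_toAlgEquiv_iff]
      intro σ hσ
      have := congrArg (fun u : (AlgebraicClosure K)ˣ => (u : AlgebraicClosure K)) (hγfix σ hσ)
      simpa only [Units.coe_smul] using this
    have hγM0 : (⟨(γ : AlgebraicClosure K), hγM⟩ : ↥M) ≠ 0 := by
      rw [Ne, ← ZeroMemClass.coe_eq_zero]
      exact γ.ne_zero
    have hζN : ((ζ : (AlgebraicClosure K)ˣ) : AlgebraicClosure K) ^ N = 1 := by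
      rw [← Units.val_pow_eq_pow_val, hζ, muVal_pow_eq_one, Units.val_one]
    refine ⟨Units.mk0 _ hγM0, ?_⟩
    -- `γ^N = x / y` in `M`
    rw [powMonoidHom_apply]
    apply Units.ext
    rw [Units.val_pow_eq_pow_val, Units.val_mk0, Units.val_mul, Units.val_inv_eq_inv_val]
    apply Subtype.ext
    push_cast
    rw [← hrt x, ← hrt y, hγ]
    push_cast [Units.val_div_eq_div_val]
    rw [div_pow, mul_pow, hζN, mul_one, div_eq_mul_inv]
  -- descend to the quotient via representatives
  refine ⟨fun q => F q.out, fun q₁ q₂ h => ?_⟩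
  have hk := key _ _ h
  rw [← QuotientGroup.out_eq' q₁, ← QuotientGroup.out_eq' q₂, QuotientGroup.eq]
  have : (q₁.out)⁻¹ * q₂.out = (q₁.out * (q₂.out)⁻¹)⁻¹ := by
    rw [mul_inv_rev, inv_inv, mul_comm]
  rw [this]
  exact Subgroup.inv_mem _ hk

/-! ### The cardinality forms over a non-archimedean local field of characteristic `0` -/

variable [ValuativeRel K] [TopologicalSpace K] [IsNonarchimedeanLocalField K] [CharZero K]

/-- **`#(M^×/M^{×N}) ≤ #H¹_cont(H, μ_N(K̄)|_H)`** for `M = K̄^H`, `H ≤ G_K` open, over a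
non-archimedean local field `K` of characteristic `0` (the target is finite: Serre, *CG* II §5.2
Prop. 14, the tree's `finite_continuousCohomology_one_restrict`).
[cite: NeukirchANT1999, Ch. IV §3 Cor. (3.6)] [cite: SerreGaloisCohomology1997, II §5.2 Prop. 14] -/
theorem natCard_unitsModPow_fixedField_le_natCard_h1_mu (hH : IsOpen (H : Set (absoluteGaloisGroup K))) :
    Nat.card ((↥(fixedField (H.map (absoluteGaloisGroup.toAlgEquiv K).toMonoidHom)))ˣ ⧸
        (powMonoidHom N : _ →* _).range) ≤
      Nat.card (continuousCohomology 1 ((mu K N).restrict (subgroupIncl H)).toTopRep) := by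
  haveI : NeZero (N : K) := ⟨Nat.cast_ne_zero.2 (NeZero.ne N)⟩
  haveI : IsClosed (H : Set (absoluteGaloisGroup K)) := OpenSubgroup.isClosed ⟨H, hH⟩
  haveI : Finite (absoluteGaloisGroup K ⧸ H) := Subgroup.quotient_finite_of_isOpen H hH
  haveI : Finite (MuCarrier K N) := finite_muCarrier K N
  haveI := finite_continuousCohomology_one_restrict K H (mu K N)
  obtain ⟨G, hG⟩ := exists_injective_unitsModPow_fixedField_to_h1 H N
  exact Nat.card_le_card_of_injective G hG

variable (L : IntermediateField K (AlgebraicClosure K)) [Normal K L] [FiniteDimensional K L]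
  [H.Normal] (hH : IsOpen (H : Set (absoluteGaloisGroup K))) (S : StableSubmonoid L)

/-- **(I_M) at the arithmetic context** (FrdII Def. 2.2 (ii)(c) coefficients): for
`X = ofLocalField L H hH S` with `μ_N(K̄) ⊆ L` and `O^□_L` containing the `N`-th roots of unity
of `L`, **`#(M^×/M^{×N}) ≤ #H¹_cont(H, μ_N(A))`**, `M = K̄^H`, `H` acting on
`μ_N(A) = μ_N(O^□_L)` through `H ↠ H_A` — the previous bound transported along the coefficient
isomorphism `μ_N(A) ≅ μ_N(K̄)|_H` (`muCoeffIso`, `cohomologyEquiv_ofGalois`).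
[cite: MochizukiFrdII2008, Rmk 2.2.1 p.18] [cite: NeukirchANT1999, Ch. IV §3 Cor. (3.6)] -/
theorem natCard_unitsModPow_fixedField_le_natCard_h1
    (hS : ∀ x : L, x ^ N = 1 → x ∈ S.toSubmonoid)
    (hμ : ∀ ζ : rootsOfUnity N (AlgebraicClosure K), ((ζ : (AlgebraicClosure K)ˣ) : AlgebraicClosure K) ∈ L) :
    Nat.card ((↥(fixedField (H.map (absoluteGaloisGroup.toAlgEquiv K).toMonoidHom)))ˣ ⧸
        (powMonoidHom N : _ →* _).range) ≤
      Nat.card (continuousCohomology 1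
        (TopRep.res ((ofLocalField L H hH S).qHA : (ofLocalField L H hH S).H →* (ofLocalField L H hH S).HA)
          (Kummer.muTopRep N (GalMonoid S) (ofLocalField L H hH S).HA))) := by
  have hcard : Nat.card (continuousCohomology 1
        (TopRep.res ((ofLocalField L H hH S).qHA : (ofLocalField L H hH S).H →* (ofLocalField L H hH S).HA)
          (Kummer.muTopRep N (GalMonoid S) (ofLocalField L H hH S).HA))) =
      Nat.card (continuousCohomology 1 ((mu K N).restrict (subgroupIncl H)).toTopRep) :=
    Nat.card_congr (cohomologyEquiv_ofGalois L (GalMonoid S) H hH (MonoidHom.id _) (fun _ _ => rfl)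
      (muModelOfSubmonoid L S N hS (NeZero.pos N) hμ) 1).toEquiv
  rw [hcard]
  exact natCard_unitsModPow_fixedField_le_natCard_h1_mu H N hH

omit [ValuativeRel K] [TopologicalSpace K] [IsNonarchimedeanLocalField K] [NeZero N] in
include hH in
/-- **`[K̄^H : K] < ∞` for an open normal subgroup `H ⊴ G_K`** (`K` of characteristic `0`):
`H = Gal(K̄/E₀)` for a finite Galois `E₀/K` (`exists_galFixing_eq`) and `K̄^{Gal(K̄/E₀)} = E₀`
(infinite Galois correspondence). [cite: MochizukiFrdII2008, Def 2.2 (i) p.17] -/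
theorem finiteDimensional_fixedField_map_of_isOpen :
    FiniteDimensional K ↥(fixedField (H.map (absoluteGaloisGroup.toAlgEquiv K).toMonoidHom)) := by
  obtain ⟨E₀, hfin, _, hE⟩ := exists_galFixing_eq H hH
  have hmap : H.map (absoluteGaloisGroup.toAlgEquiv K).toMonoidHom = E₀.fixingSubgroup := by
    rw [← hE]
    exact Subgroup.map_comap_eq_self_of_surjective (absoluteGaloisGroup.toAlgEquiv K).surjective _
  rw [hmap, InfiniteGalois.fixedField_fixingSubgroup]
  exact hfin

/-- **(I_M) after (P1), consumer form for the general-`N` closer**: for ANY finite extension `F`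
of `K` with a `K`-homomorphism `f : F → M = K̄^H` (e.g. `F = L^{H_A} = L ∩ M`),
**`#(F^×/F^{×N}) ≤ #H¹_cont(H, μ_N(A))`** at `X = ofLocalField L H hH S` — the local unit-index
monotonicity `#(F^×/F^{×N}) ≤ #(M^×/M^{×N})` (`LocalUnitIndex.natCard_quotient_range_powMonoidHom_le_of_algHom`,
Neukirch II (5.8)) followed by the Kummer injection.
[cite: MochizukiFrdII2008, Rmk 2.2.1 p.18] [cite: NeukirchANT1999, Ch. IV §3 Cor. (3.6)] -/
theorem natCard_unitsModPow_le_natCard_h1_of_algHom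
    (hS : ∀ x : L, x ^ N = 1 → x ∈ S.toSubmonoid)
    (hμ : ∀ ζ : rootsOfUnity N (AlgebraicClosure K), ((ζ : (AlgebraicClosure K)ˣ) : AlgebraicClosure K) ∈ L)
    {F : Type} [Field F] [Algebra K F] [FiniteDimensional K F]
    (f : F →ₐ[K] ↥(fixedField (H.map (absoluteGaloisGroup.toAlgEquiv K).toMonoidHom))) :
    Nat.card (Fˣ ⧸ (powMonoidHom N : Fˣ →* Fˣ).range) ≤
      Nat.card (continuousCohomology 1
        (TopRep.res ((ofLocalField L H hH S).qHA : (ofLocalField L H hH S).H →* (ofLocalField L H hH S).HA)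
          (Kummer.muTopRep N (GalMonoid S) (ofLocalField L H hH S).HA))) := by
  haveI := finiteDimensional_fixedField_map_of_isOpen (K := K) H hH
  exact (LocalUnitIndex.natCard_quotient_range_powMonoidHom_le_of_algHom K f (NeZero.ne N)).trans
    (natCard_unitsModPow_fixedField_le_natCard_h1 H N L hH S hS hμ)

end KummerInjection

end Def22Context

end PadicKummer

end Literature.AlgebraicGeometry.Frobenioids

end
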